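import Summits.BirchSwinnertonDyer.BirchSwinnertonDyer.Theorems.EisensteinPrimesLocallyTrivialAwayIndex
import Literature.NumberTheory.EllipticCurves.ZpExtensionRestrictShift
import HarnessLib

/-!
# Road α, crux `PrintCf2.SplitBadTwoRankOneOfFacts` (stmt-BirchSwinnertonDyer-20368), brick (RES)(b2-ii), file 2/3: LOCAL GROUP THEORY AT A RAMIFIED
# PLACE OF A `ℤ_p`-LINE — `Γ_F/I_F` is abelian, `res⁻¹(ker κ)·I_F` is open, and `res⁻¹(ker κ)` has at most one open index-`2` subgroup over `I_F`

Cell `bsd-print-cf2`, width seat `bsd-line-cf2-p1-w6` g4; `--supports stmt-BirchSwinnertonDyer-20368 --as helper`. HONEST FRAMING: nothing here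
closes the crux or a registered stub; no summit statement is proved by this seat; BSD is not proved by any of this. No definition, no named
fact, no `sorry`.

Setting of (RES)(b2) (cf2c-w8 g0's TURNKEY `Cruxes/RestrictedMainConjWithValueAtTwo/RES-LOCAL-DEFECT-cf2c-w8.md` §2 (V̄), corrected by p685012):
over the line `K*_∞ = K̄^{ker κ₂}` the Greenberg group `S_{W*}(K*_∞)` (= `J`, p685638) and Agboola's `𝔖_v̄(K*_∞, W*)` differ ABOVE `v̄` by
`Def(v̄) = ker (H¹(ker κ₂ ⊓ D_v̄, W*) → H¹(ker κ₂ ⊓ I_v̄, W*))`; by (C3) `ker κ₂` acts on `W*` through `{±1}`. `Def(v̄) = 0` exactly when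
`ker κ₂ ⊓ I_v̄` acts trivially on `W*` and some `δ₀ ∈ ker κ₂ ⊓ D_v̄` acts as `−1` («mover outside inertia»: road α `d ≡ 7 (mod 8)`, `d ≡ 6 (mod 16)`);
`Def(v̄) ≅ ℤ/2` for an inertial mover (`d ≡ 2, 10 (mod 16)`); `Def(v̄) ⊇ Hom_cont(Ẑ, W*) ≅ ℚ₂/ℤ₂` when `ker κ₂ ⊓ D_v̄` acts trivially
(`d ≡ 3 (mod 8)`, `d ≡ 14 (mod 16)`).

THIS FILE (any number field `K`, finite place `w`, `F = K_w`, `Q = Γ_F ⧸ I_F ≅ Ẑ` by `isFreeProcyclic_quotient_galUnr`):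
* `commutator_mem_galUnr`, `commutator_mem_inertia` — `Γ_F/I_F` (resp. `D_w/I_w`) is abelian (`mul_comm_of_dense_zpowers`);
* `isOpen_comap_kerSubgroup_sup_galUnr` — for a `ℤ_p`-line `κ` RAMIFIED at `w` (`I_w ≰ ker κ`), `H_F · I_F` is OPEN in `Γ_F`, `H_F = res⁻¹(ker κ)`: the image
  `κ(I_w) ≤ ℤ_p` is a non-zero closed subgroup, hence `⊇ p^a ℤ_p` (`ZpExtension.mul_mem_of_isClosed_addSubgroup`, `PadicInt.unitCoeff_spec`), so
  `H_F · I_F ⊇ res⁻¹(κ⁻¹(p^a ℤ_p))` (`isOpen_layerSubgroup`);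
* **`eq_of_isOpen_of_index_two`** — hypothesis (U′) of file 1 for `G = H` a CLOSED subgroup of `Γ_F` with `H · I_F` open and `N = H ⊓ I_F`: two open
  index-`2` subgroups of `H` containing `H ⊓ I_F` coincide (their products with `I_F` are open of the same index `2·[Γ_F : H·I_F]` in `Γ_F ⊇ I_F`, hence
  have the same image in `Q`, where an open subgroup is determined by its index — `eq_closureZpowersPow_of_isOpen_of_index`; and `U = (U·I_F) ⊓ H`).

presearch: Neukirch ANT II (9.9); Serre Galois Cohomology II §5.1; Washington §13.1; tree `FreeProcyclicStructure` (Mochizuki AbsTopI §0 p. 7) —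
held; no new fact. beyond-print theorem: no.

References: [NeukirchANT1999] II §9 (9.9); [SerreGaloisCohomology1997] II §5.1; [Washington1997] §13.1; [MochizukiAbsTopI2012] §0 p. 7.
-/

set_option autoImplicit false
set_option linter.dupNamespace false

noncomputable section

open scoped Classical Pointwise
open NumberField IsDedekindDomain Field Multiplicative
open Literature.NumberTheory.EllipticCurves Literature.NumberTheory.GaloisRepresentations
  Literature.AnabelianGeometry.AbsoluteAnabelian

namespace Summit.BirchSwinnertonDyer.BirchSwinnertonDyer.Theorems.PrintCf2.LineLocallyTrivial

/-! ## §2. Local group theory at a finite place: `Γ_F/I_F` abelian; `H_F·I_F` open for a ramified line; uniqueness of index-2 subgroups -/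

section Local

variable {K : Type} [Field K] [NumberField K] (w : HeightOneSpectrum (𝓞 K))

/-- **`Γ_F ⧸ I_F` is abelian** (`F = K_w`): every commutator of `Γ_F` lies in `I_F = galUnr F` (the quotient has a dense cyclic subgroup,
`isFreeProcyclic_quotient_galUnr`, `mul_comm_of_dense_zpowers`). [cite: NeukirchANT1999, II §9 (9.9)] [cite: MochizukiAbsTopI2012, §0 p. 7] -/
theorem commutator_mem_galUnr (s t : absoluteGaloisGroup (w.adicCompletion K)) :
    s * t * s⁻¹ * t⁻¹ ∈ galUnr (w.adicCompletion K) := by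
  haveI : IsClosed ((galUnr (w.adicCompletion K) : Subgroup (absoluteGaloisGroup (w.adicCompletion K))) :
      Set (absoluteGaloisGroup (w.adicCompletion K))) := isClosed_galUnr (w.adicCompletion K)
  obtain ⟨⟨g, hg⟩, -⟩ := isFreeProcyclic_quotient_galUnr (w.adicCompletion K)
  have hc := mul_comm_of_dense_zpowers hg (QuotientGroup.mk s : absoluteGaloisGroup (w.adicCompletion K) ⧸ galUnr (w.adicCompletion K))
    (QuotientGroup.mk t)
  rw [← QuotientGroup.eq_one_iff, QuotientGroup.mk_mul, QuotientGroup.mk_mul, QuotientGroup.mk_mul, QuotientGroup.mk_inv,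
    QuotientGroup.mk_inv, hc, mul_inv_cancel_right, mul_inv_cancel]

/-- On the `Γ_K` side: commutators of the decomposition group `D_w` lie in the inertia group `I_w`. [cite: NeukirchANT1999, II §9 (9.9)] -/
theorem commutator_mem_inertia {x y : absoluteGaloisGroup K} (hx : x ∈ GreenbergSelmer.decomp w) (hy : y ∈ GreenbergSelmer.decomp w) :
    x * y * x⁻¹ * y⁻¹ ∈ GreenbergSelmer.inertia w := by
  obtain ⟨s, rfl⟩ := (GreenbergSelmer.mem_decomp_iff w x).mp hx
  obtain ⟨t, rfl⟩ := (GreenbergSelmer.mem_decomp_iff w y).mp hy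
  refine ⟨s * t * s⁻¹ * t⁻¹, ?_, by simp only [map_mul, map_inv]; rfl⟩
  rw [← galUnr_eq_absInertia]
  exact commutator_mem_galUnr w s t

variable {p : ℕ} [Fact p.Prime] (κ : ZpExtension K p)

/-- **For a `ℤ_p`-line RAMIFIED at `w`, `H_F · I_F` is OPEN in `Γ_F`** (`H_F = res⁻¹(ker κ)`): the image `κ(I_w) ≤ ℤ_p` is a non-zero closed subgroup,
hence contains `p^a ℤ_p` (`ZpExtension.mul_mem_of_isClosed_addSubgroup`, `PadicInt.unitCoeff_spec`), so `H_F · I_F ⊇ res⁻¹(κ⁻¹(p^a ℤ_p))`, an open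
subgroup (`isOpen_layerSubgroup`). [cite: Washington1997, §13.1] [cite: SerreGaloisCohomology1997, II §5.1] -/
theorem isOpen_comap_kerSubgroup_sup_galUnr (hram : ¬ GreenbergSelmer.inertia w ≤ κ.kerSubgroup) :
    IsOpen ((κ.kerSubgroup.comap (absGaloisRestrict K (w.adicCompletion K)).toMonoidHom ⊔ galUnr (w.adicCompletion K) :
      Subgroup (absoluteGaloisGroup (w.adicCompletion K))) : Set (absoluteGaloisGroup (w.adicCompletion K))) := by
  haveI : CompactSpace (absoluteGaloisGroup (w.adicCompletion K)) := absoluteGaloisGroup_compactSpace (w.adicCompletion K)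
  set res := absGaloisRestrict K (w.adicCompletion K) with hres
  set L : Subgroup (absoluteGaloisGroup (w.adicCompletion K)) := κ.kerSubgroup.comap res.toMonoidHom ⊔ galUnr (w.adicCompletion K) with hL
  -- a ramified inertia element
  obtain ⟨i, hiI, hiκ⟩ : ∃ i ∈ galUnr (w.adicCompletion K), κ (res i) ≠ 1 := by
    by_contra h
    push Not at h
    refine hram fun τ hτ ↦ ?_
    obtain ⟨j, hj, rfl⟩ := Subgroup.mem_map.mp hτ
    rw [← galUnr_eq_absInertia] at hj
    exact ZpExtension.mem_kerSubgroup.mpr (h j hj)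
  -- the closed subgroup `C = κ(res I_F) ≤ ℤ_p`
  let f : absoluteGaloisGroup (w.adicCompletion K) →* Multiplicative ℤ_[p] := κ.toContinuousMonoidHom.toMonoidHom.comp res.toMonoidHom
  have hf : ∀ s, f s = κ (res s) := fun _ ↦ rfl
  have hfc : Continuous f := κ.toContinuousMonoidHom.continuous.comp res.continuous
  set C : AddSubgroup ℤ_[p] := AddSubgroup.toSubgroup.symm ((galUnr (w.adicCompletion K)).map f) with hCdef
  have hmemC : ∀ x : ℤ_[p], x ∈ C ↔ ∃ j ∈ galUnr (w.adicCompletion K), κ (res j) = Multiplicative.ofAdd x := fun x ↦ by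
    rw [hCdef]
    change Multiplicative.ofAdd x ∈ (galUnr (w.adicCompletion K)).map f ↔ _
    rw [Subgroup.mem_map]
    rfl
  have hCc : IsClosed (C : Set ℤ_[p]) := by
    have hcpt : IsCompact (((galUnr (w.adicCompletion K)).map f : Subgroup (Multiplicative ℤ_[p])) : Set (Multiplicative ℤ_[p])) := by
      rw [Subgroup.coe_map]
      exact ((isClosed_galUnr (w.adicCompletion K)).isCompact).image hfc
    have : (C : Set ℤ_[p]) = Multiplicative.ofAdd ⁻¹' (((galUnr (w.adicCompletion K)).map f : Subgroup (Multiplicative ℤ_[p])) :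
        Set (Multiplicative ℤ_[p])) := rfl
    rw [this]
    exact hcpt.isClosed.preimage continuous_ofAdd
  -- `x := κ(res i) ∈ C`, `x ≠ 0`, so `p^a ℤ_p ⊆ C` with `a = v(x)`
  set x : ℤ_[p] := Multiplicative.toAdd (κ (res i)) with hx
  have hxC : x ∈ C := (hmemC x).mpr ⟨i, hiI, by rw [hx, ofAdd_toAdd]⟩
  have hx0 : x ≠ 0 := fun h0 ↦ hiκ (by rw [← ofAdd_toAdd (κ (res i)), ← hx, h0, ofAdd_zero])
  set a : ℕ := x.valuation with ha
  have hpa : ∀ y : ℤ_[p], (p : ℤ_[p]) ^ a ∣ y → y ∈ C := by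
    rintro y ⟨c, rfl⟩
    have hpC : (p : ℤ_[p]) ^ a ∈ C := by
      have hspec : x = (PadicInt.unitCoeff hx0 : ℤ_[p]) * (p : ℤ_[p]) ^ a := PadicInt.unitCoeff_spec hx0
      have h1 : (p : ℤ_[p]) ^ a = ((PadicInt.unitCoeff hx0)⁻¹ : ℤ_[p]ˣ) * x := by
        calc (p : ℤ_[p]) ^ a = ((PadicInt.unitCoeff hx0)⁻¹ : ℤ_[p]ˣ) * ((PadicInt.unitCoeff hx0 : ℤ_[p]) * (p : ℤ_[p]) ^ a) := by
              rw [← mul_assoc, Units.inv_mul, one_mul]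
          _ = ((PadicInt.unitCoeff hx0)⁻¹ : ℤ_[p]ˣ) * x := by rw [← hspec]
      rw [h1]
      exact ZpExtension.mul_mem_of_isClosed_addSubgroup C hCc _ hxC
    have := ZpExtension.mul_mem_of_isClosed_addSubgroup C hCc c hpC
    rwa [mul_comm] at this
  -- `L ⊇ res⁻¹(κ⁻¹(p^a ℤ_p))`, an open neighbourhood of `1`
  have hsub : ((κ.layerSubgroup a).comap res.toMonoidHom : Set (absoluteGaloisGroup (w.adicCompletion K))) ⊆ (L : Set _) := by
    intro s hs
    have hs' : (p : ℤ_[p]) ^ a ∣ (κ (res s)).toAdd := ZpExtension.mem_layerSubgroup.mp hs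
    obtain ⟨j, hj, hjs⟩ := (hmemC _).mp (hpa _ hs')
    rw [ofAdd_toAdd] at hjs
    have hsj : s * j⁻¹ ∈ κ.kerSubgroup.comap res.toMonoidHom := by
      change res (s * j⁻¹) ∈ κ.kerSubgroup
      rw [ZpExtension.mem_kerSubgroup, map_mul, map_inv, map_mul, map_inv, hjs, mul_inv_cancel]
    have : s = (s * j⁻¹) * j := by group
    rw [SetLike.mem_coe, this]
    exact Subgroup.mul_mem _ (Subgroup.mem_sup_left hsj) (Subgroup.mem_sup_right hj)
  refine Subgroup.isOpen_of_mem_nhds L (Filter.mem_of_superset ?_ hsub) (g := 1)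
  refine ((κ.isOpen_layerSubgroup a).preimage res.continuous).mem_nhds ?_
  simp only [Set.mem_preimage, SetLike.mem_coe]
  rw [show res.toContinuousMap 1 = 1 from map_one res]
  exact Subgroup.one_mem _

/-- **(U′) for `G = H_F`, `N = H_F ⊓ I_F`.** For a CLOSED subgroup `H ≤ Γ_F` with `H · I_F` OPEN, any two open subgroups of `H` of index `2`
containing `H ⊓ I_F` coincide: their products with `I_F` are open subgroups of `Γ_F ⊇ I_F` of the same index `2·[Γ_F : H·I_F]`, hence have the same
image in `Γ_F ⧸ I_F ≅ Ẑ`, where an open subgroup is determined by its index (`eq_closureZpowersPow_of_isOpen_of_index`); and `U = (U·I_F) ⊓ H`.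
[cite: MochizukiAbsTopI2012, §0 p. 7] [cite: SerreGaloisCohomology1997, II §5.1] -/
theorem eq_of_isOpen_of_index_two (H : Subgroup (absoluteGaloisGroup (w.adicCompletion K)))
    (hH : IsClosed (H : Set (absoluteGaloisGroup (w.adicCompletion K))))
    (hL : IsOpen ((H ⊔ galUnr (w.adicCompletion K) : Subgroup (absoluteGaloisGroup (w.adicCompletion K))) :
      Set (absoluteGaloisGroup (w.adicCompletion K))))
    (U₁ U₂ : Subgroup ↥H) (hU₁ : IsOpen (U₁ : Set ↥H)) (hU₂ : IsOpen (U₂ : Set ↥H))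
    (hN₁ : (galUnr (w.adicCompletion K)).subgroupOf H ≤ U₁) (hN₂ : (galUnr (w.adicCompletion K)).subgroupOf H ≤ U₂)
    (hi₁ : U₁.index = 2) (hi₂ : U₂.index = 2) : U₁ = U₂ := by
  haveI : CompactSpace (absoluteGaloisGroup (w.adicCompletion K)) := absoluteGaloisGroup_compactSpace (w.adicCompletion K)
  haveI : IsClosed ((galUnr (w.adicCompletion K) : Subgroup (absoluteGaloisGroup (w.adicCompletion K))) :
      Set (absoluteGaloisGroup (w.adicCompletion K))) := isClosed_galUnr (w.adicCompletion K)
  set Γ := absoluteGaloisGroup (w.adicCompletion K)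
  set I : Subgroup Γ := galUnr (w.adicCompletion K) with hIdef
  set L : Subgroup Γ := H ⊔ I with hLdef
  -- the two lifted subgroups `V U := U ⊔ I ≤ Γ`
  let V : Subgroup ↥H → Subgroup Γ := fun U ↦ U.map H.subtype ⊔ I
  -- recovery: `x ∈ H`, `x ∈ V U` ⇒ `x ∈ U` (for `U ⊇ H ⊓ I`)
  have hrec : ∀ U : Subgroup ↥H, I.subgroupOf H ≤ U → ∀ x : ↥H, (x : Γ) ∈ V U → x ∈ U := by
    intro U hNU x hx
    have hx' : (x : Γ) ∈ ((U.map H.subtype ⊔ I : Subgroup Γ) : Set Γ) := hx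
    rw [Subgroup.mul_normal] at hx'
    obtain ⟨u, hu, j, hj, huj⟩ := Set.mem_mul.mp hx'
    obtain ⟨u', hu', rfl⟩ := Subgroup.mem_map.mp hu
    have hjH : j ∈ H := by
      have : j = ((u' : Γ))⁻¹ * x := by rw [← huj]; simp
      rw [this]
      exact H.mul_mem (H.inv_mem u'.2) x.2
    have hjU : (⟨j, hjH⟩ : ↥H) ∈ U := hNU (Subgroup.mem_subgroupOf.mpr hj)
    have : x = u' * ⟨j, hjH⟩ := Subtype.ext (by rw [Subgroup.coe_mul]; exact huj.symm)
    rw [this]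
    exact U.mul_mem hu' hjU
  -- membership of `h * j` (`h ∈ H`, `j ∈ I`) in `V U`
  have hmemV : ∀ U : Subgroup ↥H, I.subgroupOf H ≤ U → ∀ (h : ↥H) (j : Γ), j ∈ I → ((h : Γ) * j ∈ V U ↔ h ∈ U) := by
    intro U hNU h j hj
    constructor
    · intro hm
      have : (h : Γ) ∈ V U := by
        have h1 : (h : Γ) = (h : Γ) * j * j⁻¹ := by group
        rw [h1]
        exact (V U).mul_mem hm ((V U).inv_mem (Subgroup.mem_sup_right hj))
      exact hrec U hNU h this
    · intro hm
      exact (V U).mul_mem (Subgroup.mem_sup_left (Subgroup.mem_map.mpr ⟨h, hm, rfl⟩)) (Subgroup.mem_sup_right hj)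
  -- `V U ≤ L` and `[L : V U] = 2`
  have hVle : ∀ U : Subgroup ↥H, V U ≤ L := fun U ↦
    sup_le (fun y hy ↦ by
      obtain ⟨u, -, rfl⟩ := Subgroup.mem_map.mp hy
      exact Subgroup.mem_sup_left u.2) le_sup_right
  have hrel : ∀ U : Subgroup ↥H, I.subgroupOf H ≤ U → U.index = 2 → (V U).relIndex L = 2 := by
    intro U hNU hiU
    -- an element of `H` outside `U`
    obtain ⟨g₁, hg₁⟩ : ∃ g₁ : ↥H, g₁ ∉ U := by
      by_contra h
      push Not at h
      have : U = ⊤ := top_le_iff.mp fun y _ ↦ h y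
      rw [this, Subgroup.index_top] at hiU
      exact absurd hiU (by norm_num)
    rw [Subgroup.relIndex, Subgroup.index_eq_two_iff]
    refine ⟨⟨(g₁ : Γ), Subgroup.mem_sup_left g₁.2⟩, fun b ↦ ?_⟩
    have hb : (b : Γ) ∈ ((H ⊔ I : Subgroup Γ) : Set Γ) := b.2
    rw [Subgroup.mul_normal] at hb
    obtain ⟨h, hh, j, hj, hhj⟩ := Set.mem_mul.mp hb
    rw [Subgroup.mem_subgroupOf, Subgroup.mem_subgroupOf, Subgroup.coe_mul]
    show Xor ((b : Γ) * (g₁ : Γ) ∈ V U) ((b : Γ) ∈ V U)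
    have e1 : (b : Γ) * (g₁ : Γ) = (h * g₁) * ((g₁ : Γ)⁻¹ * j * g₁) := by rw [← hhj]; group
    have hj' : (g₁ : Γ)⁻¹ * j * g₁ ∈ I := by
      have := (normal_galUnr (w.adicCompletion K)).conj_mem j hj (g₁ : Γ)⁻¹
      rwa [inv_inv] at this
    have key1 : (b : Γ) * (g₁ : Γ) ∈ V U ↔ (⟨h, hh⟩ : ↥H) * g₁ ∈ U := by
      rw [e1, show h * (g₁ : Γ) = (((⟨h, hh⟩ : ↥H) * g₁ : ↥H) : Γ) from rfl]
      exact hmemV U hNU _ _ hj'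
    have key2 : (b : Γ) ∈ V U ↔ (⟨h, hh⟩ : ↥H) ∈ U := by
      rw [← hhj]
      exact hmemV U hNU ⟨h, hh⟩ j hj
    simp only [Xor, key1, key2, Subgroup.mul_mem_iff_of_index_two hiU]
    tauto
  have hidx : ∀ U : Subgroup ↥H, I.subgroupOf H ≤ U → U.index = 2 → (V U).index = 2 * L.index := fun U hNU hiU ↦ by
    rw [← Subgroup.relIndex_mul_index (hVle U), hrel U hNU hiU]
  -- `V U` is open: closed (compact `U · I`) of finite index
  haveI : Finite (Γ ⧸ L) := Subgroup.quotient_finite_of_isOpen L hL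
  haveI hLfin : L.FiniteIndex := Subgroup.finiteIndex_of_finite_quotient
  have hLne : L.index ≠ 0 := Subgroup.index_ne_zero_of_finite
  have hVopen : ∀ U : Subgroup ↥H, IsOpen (U : Set ↥H) → I.subgroupOf H ≤ U → U.index = 2 → IsOpen ((V U : Subgroup Γ) : Set Γ) := by
    intro U hUo hNU hiU
    have hcl : IsClosed ((V U : Subgroup Γ) : Set Γ) := by
      have hUc : IsCompact ((U.map H.subtype : Subgroup Γ) : Set Γ) := by
        rw [Subgroup.coe_map]
        haveI : CompactSpace ↥H := isCompact_iff_compactSpace.mp hH.isCompact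
        exact (OpenSubgroup.isClosed ⟨U, hUo⟩).isCompact.image continuous_subtype_val
      have hIc : IsCompact ((I : Subgroup Γ) : Set Γ) := (isClosed_galUnr (w.adicCompletion K)).isCompact
      have : ((V U : Subgroup Γ) : Set Γ) = ((U.map H.subtype : Subgroup Γ) : Set Γ) * (I : Set Γ) := Subgroup.mul_normal _ _
      rw [this]
      exact (hUc.mul hIc).isClosed
    haveI : (V U).FiniteIndex := ⟨by rw [hidx U hNU hiU]; exact mul_ne_zero two_ne_zero hLne⟩
    exact Subgroup.isOpen_of_isClosed_of_finiteIndex _ hcl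
  -- images in `Q = Γ ⧸ I`: equal, by uniqueness of the open subgroup of a given index
  obtain ⟨⟨g, hg⟩, -⟩ := isFreeProcyclic_quotient_galUnr (w.adicCompletion K)
  set π := QuotientGroup.mk' I with hπ
  have hker : ∀ U : Subgroup ↥H, π.ker ≤ V U := fun U ↦ by
    rw [hπ, QuotientGroup.ker_mk']
    exact le_sup_right
  have himg : ∀ U : Subgroup ↥H, IsOpen (U : Set ↥H) → I.subgroupOf H ≤ U → U.index = 2 →
      (V U).map π = (Subgroup.zpowers (g ^ (2 * L.index))).topologicalClosure := by
    intro U hUo hNU hiU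
    refine eq_closureZpowersPow_of_isOpen_of_index hg ?_ (Nat.pos_of_ne_zero (mul_ne_zero two_ne_zero hLne)) ?_
    · have ho := QuotientGroup.isOpenMap_coe (N := I) _ (hVopen U hUo hNU hiU)
      rw [Subgroup.coe_map]
      exact ho
    · rw [← hidx U hNU hiU, ← Subgroup.index_comap_of_surjective ((V U).map π) (QuotientGroup.mk'_surjective I),
        Subgroup.comap_map_eq_self (hker U)]
  have hV : V U₁ = V U₂ := by
    rw [← Subgroup.comap_map_eq_self (hker U₁), ← Subgroup.comap_map_eq_self (hker U₂), himg U₁ hU₁ hN₁ hi₁, himg U₂ hU₂ hN₂ hi₂]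
  ext x
  exact ⟨fun hx ↦ hrec U₂ hN₂ x (hV ▸ Subgroup.mem_sup_left (Subgroup.mem_map.mpr ⟨x, hx, rfl⟩)),
    fun hx ↦ hrec U₁ hN₁ x (hV.symm ▸ Subgroup.mem_sup_left (Subgroup.mem_map.mpr ⟨x, hx, rfl⟩))⟩

end Local


end Summit.BirchSwinnertonDyer.BirchSwinnertonDyer.Theorems.PrintCf2.LineLocallyTrivial

end
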